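import Literature.MathematicalPhysics.QuantumLattice.FermiRG.FKTLaddersResectorizationSupport
import Literature.MathematicalPhysics.QuantumLattice.FermiRG.FKTLaddersResectorizationAllPos

/-!
# Feldman–Knörrer–Trubowitz, *Particle–Hole Ladders*: Lemma II.16 at `δ⃗ = 0`, every component and side pattern

Theorem-only companion of the typer file `FKTLaddersSec1.lean` (F7a, frozen; nothing there is edited)
for the cell `gate-hubbard-kl` (seat hubbard-kl-t11, gen 2, 2026-08-27; DAG file id F7l): the ASSEMBLY
of Lemma II.16 (`\lemLADresectornorm`; tree: the named fact `FKTLadders.ResectorizationNormBound`,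
licence F-075 — NOT discharged here, see below) of J. Feldman, H. Knörrer, E. Trubowitz,
*Particle–Hole Ladders*, Commun. Math. Phys. **247** (2004) 179–194, arXiv:math-ph/0209044
[FeldmanKnorrerTrubowitz2004Ladders], in the derivative-free case `δ⃗ = (0,0,0)`, for EVERY leg-kind
component and EVERY side pattern `1 ≤ ℓ' ≤ ℓ`, `1 ≤ r' ≤ r`.  Locators `p.N Ln` = chunk `pNNNN.txt`
line `n` of the materialised arXiv TeX, as in F7a.

MAIN THEOREM (`resectScaledNormMax_zero_le_of_le`): for admissible ladder data with `χ̂`-decay constant `cst`,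
`f` on `𝔜_{ℓ',r'}` sectorized (Definition I.6), translation invariant (Definition I.4) and with Borel
measurable components,
`|f|^{[0,0,0]}_{ℓ,r} = |f_{Σ_ℓ,Σ_r}|^{[0,0,0]}_{ℓ,r} ≤ 3⁴ · max(1,cst)⁴ · |f|^{[0,0,0]}_{ℓ',r'}`;
`resectorizationNormBound_deltaZero` restates it in the two-inequality shape of the printed Lemma
(and of the named fact) with the constant existentially quantified.  The STRICT side pattern
`ℓ' < ℓ`, `r' < r` (the case the paper writes out; every position leg changes scale) is also t10's
`resectScaledNormMax_zero_le` (`FKTLaddersSupportVanishingSingle`, by pointwise Fourier inversion on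
the single-leg components); the one-sided patterns `ℓ' = ℓ` or `r' = r` ("the other cases are similar,
but easier", p.13 L37–38) are where the almost-everywhere route below is needed.

THE PRINTED PROOF (p.13 L37–72) AND ITS DISTRIBUTION OVER THE TREE.  Definition I.18 writes
`f_{Σ_ℓ,Σ_r}` as a sum over old labels `s'` of `χ̂`-convolutions on the position legs that change scale;
(i) "for any fixed `s₁,…,s₄` there are at most `3⁴` choices of `(s'₁,…,s'₄)` for which the integral fails
to vanish identically, because `f` is sectorized" (p.13 L48–53); (iii)–(iv) `|∫ ∏χ̂ f| ≤ ∫ ∏|χ̂| |f|`,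
Tonelli, `‖χ̂_s‖_{L¹} ≤ const` (p.13 L55–72, L91–96); (ii), Leibniz, is void at `δ⃗ = 0`.  Steps
(iii)–(iv) and the count are F7h (`FKTLaddersResectorizationCore`); the geometry of (i) is F7i
(`FKTLaddersSectorCounting`); the vanishing in (i) is F7j/F7m (all position legs change scale), the
sibling `FKTLaddersResectorizationSupport` (exactly one position leg keeps its scale; a single position
leg) and §3–§4 here (two position legs keep their scale).  Write `P` for the position legs of a
component, `chg ⊆ P` for those on a side that changes scale.

* §5 `legNorm_resectFour_le_of_neighbours_ae` / `resectScaledNormMax_zero_le_of_neighbours_ae`: F7h's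
  component bound and its sum, GENERALISED to a survivor map that may depend on the frozen momenta
  and to summands that vanish only almost everywhere on each slice of the `L¹–L^∞` norm (the dropped
  summands are removed under the slice integral, `lintegral_mono_ae`).  Both generalisations are
  forced by the tree's quantifiers: for `|P| = 1` the survivors are the `≤ 2` old sectors containing the
  CONSERVED momentum of the frozen momentum legs (F7i `card_filter_mem_extSector_le_two`), and for
  `|P ∖ chg| = 2` the summand vanishes only almost everywhere (next item).
* §3–§4 `ae_integral_resect_eq_zero_of_disjoint_twoFree`: when one side changes scale and the other
  side has two position legs `π ≠ π'`, the `s'`-summand does NOT vanish identically for the `f`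
  quantified over (translation invariance, sectorization — a condition on the total Fourier transform,
  i.e. on the almost-everywhere class of the pinned function — and measurability all survive a
  modification of `f` on the translation-invariant null set `{y_{π'} - y_π ∈ N}`), but it vanishes at
  almost every point of every slice: translating by `y_π` (Definition I.4 (ii)) writes it as a
  momentum-leg phase times the `χ̂`-convolution in the convolved legs of the section pinned at `π`, at
  the free difference `d = y_{π'} - y_π`; for fixed momenta `q` of the convolved legs with `q_ν` outside
  the old sector, the partial phase transform in those legs is an integrable function of `d` all of
  whose `⟨·,·⟩_-`-Fourier coefficients are transforms pinned at `π`, hence zero by sectorization (F7m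
  `pinFT_eq_zero_of_not_mem_extSector'`), so it vanishes for a.e. `d` by UNIQUENESS OF THE FOURIER
  TRANSFORM ON `L¹` (sibling `ae_eq_zero_of_forall_integral_mink_eq_zero`, transport of the tree's
  `Literature.Analysis.Fourier` statement of Katznelson Ch. VI §1.11); a Tonelli exchange on
  `(q, d)`-space (§1) makes the exceptional set independent of `q`, the almost-everywhere form of F7j's
  Fubini computation (§2, `integral_prod_chiHat_mul_eq_zero_of_ae`) gives the vanishing for a.e. `d`,
  and the difference of two free slice coordinates (or of a free and the frozen one) almost never lies
  in a null set (§1).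

HYPOTHESES beyond print: measurability of the components (Tonelli on lower integrals, F7h); the
leg-integrability used by the support step is derived from finiteness of the old norm (F7h §8; for an
infinite old norm the bound is trivial).  WHAT IS NOT DONE: the named fact `ResectorizationNormBound`
quantifies over all `δ⃗ ∈ Δ⃗` (the Leibniz step through `diffDecay`'s iterated `lineDeriv` needs a
regularity class) and over all `f : FourLegFn` (no measurability); it is not discharged.  Theorem-only:
no `def`, no named fact (D-0026), no `instance`, no `notation`; nothing about the Hubbard model is
asserted.
-/

noncomputable section

open MeasureTheory Set

namespace Literature.MathematicalPhysics.QuantumLattice.FermiRG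

namespace FKTLadders

/-! ### §1 Measure-theoretic preliminaries -/

/-- `volume` on `ℝ × ℝ²` is an additive Haar measure. [folklore] -/
private theorem isAddHaarMeasure_volume_SpT' : (volume : Measure SpT).IsAddHaarMeasure := by
  rw [Measure.volume_eq_prod]; infer_instance

/-- `volume` on `ℝ × ℝ²` is invariant under right translations. [folklore] -/
private theorem isAddRightInvariant_volume_SpT' : (volume : Measure SpT).IsAddRightInvariant :=
  Measure.prod.instIsAddRightInvariant

/-- `volume` on `ℝ × ℝ²` is invariant under `x ↦ -x`. [folklore] -/
private theorem isNegInvariant_volume_SpT' : (volume : Measure SpT).IsNegInvariant := by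
  haveI := isAddHaarMeasure_volume_SpT'; infer_instance

/-- `volume` on a finite power of `ℝ × ℝ²` is invariant under right translations. [folklore] -/
private theorem isAddRightInvariant_volume_pi_SpT'' {κ : Type*} [Fintype κ] :
    (volume : Measure (κ → SpT)).IsAddRightInvariant := by
  haveI := isAddHaarMeasure_volume_SpT'
  show (Measure.pi fun _ : κ => (volume : Measure SpT)).IsAddRightInvariant
  infer_instance

/-- An a.e.-strongly measurable function on a product which, for EVERY value of the first variable,
vanishes for almost every value of the second, vanishes almost everywhere for the product measure
(Tonelli on the zero set of a strongly measurable version). [folklore] -/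
private theorem ae_prod_eq_zero_of_forall_ae {α β : Type*} [MeasurableSpace α] [MeasurableSpace β]
    {μ : Measure α} {ν : Measure β} [SFinite μ] [SFinite ν] {Ξ : α × β → ℂ}
    (hΞ : AEStronglyMeasurable Ξ (μ.prod ν)) (h : ∀ x, ∀ᵐ y ∂ν, Ξ (x, y) = 0) :
    Ξ =ᵐ[μ.prod ν] 0 := by
  have h1 : Ξ =ᵐ[μ.prod ν] hΞ.mk Ξ := hΞ.ae_eq_mk
  have h2 : ∀ᵐ x ∂μ, ∀ᵐ y ∂ν, Ξ (x, y) = hΞ.mk Ξ (x, y) := Measure.ae_ae_of_ae_prod h1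
  have hset : MeasurableSet {z : α × β | hΞ.mk Ξ z = 0} :=
    hΞ.stronglyMeasurable_mk.measurableSet_eq_fun stronglyMeasurable_const
  have h3 : ∀ᵐ z ∂μ.prod ν, hΞ.mk Ξ z = 0 := by
    rw [Measure.ae_prod_iff_ae_ae hset]
    filter_upwards [h2] with x hx
    filter_upwards [hx, h x] with y hy hy'
    rw [← hy]
    exact hy'
  exact h1.trans h3

/-- Exchanging the order of "almost every": if `Ξ = 0` a.e. for `μ × ν` then for a.e. `y`, for a.e.
`x`, `Ξ (x, y) = 0`. [folklore] -/
private theorem ae_ae_swap_of_ae_prod {α β : Type*} [MeasurableSpace α] [MeasurableSpace β]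
    {μ : Measure α} {ν : Measure β} [SFinite μ] [SFinite ν] {Ξ : α × β → ℂ}
    (h : Ξ =ᵐ[μ.prod ν] 0) : ∀ᵐ y ∂ν, ∀ᵐ x ∂μ, Ξ (x, y) = 0 := by
  have hswap : (Ξ ∘ Prod.swap) =ᵐ[ν.prod μ] ((0 : α × β → ℂ) ∘ Prod.swap) :=
    (Measure.measurePreserving_swap (μ := ν) (ν := μ)).quasiMeasurePreserving.ae_eq_comp h
  exact Measure.ae_ae_of_ae_prod hswap

/-- A coordinate of a finite power of `ℝ × ℝ²` almost never lies in a null set. [folklore] -/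
private theorem volume_eval_mem_null {κ : Type*} [Fintype κ] (j : κ) {A : Set SpT}
    (hA : volume A = 0) : volume {x : κ → SpT | x j ∈ A} = 0 := by
  rw [volume_pi]
  exact Measure.pi_eval_preimage_null (fun _ : κ => (volume : Measure SpT)) hA

/-- The difference of two distinct coordinates of a finite power of `ℝ × ℝ²` almost never lies in a
null set (split off the first coordinate, Tonelli, translation invariance). [folklore] -/
private theorem volume_sub_mem_null {κ : Type*} [Fintype κ] [DecidableEq κ] (a b : κ) (hab : a ≠ b)
    {N : Set SpT} (hN : MeasurableSet N) (hN0 : volume N = 0) :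
    volume {x : κ → SpT | x a - x b ∈ N} = 0 := by
  haveI := isAddHaarMeasure_volume_SpT'
  haveI := isNegInvariant_volume_SpT'
  obtain ⟨Φ, hΦmp, hΦa, hΦe, -⟩ := exists_measurableEquiv_insert' (X := SpT) (κ := κ)
    (κ' := {m : κ // m ≠ a}) a (Equiv.refl _)
  have hB : MeasurableSet {x : κ → SpT | x a - x b ∈ N} :=
    ((measurable_pi_apply a).sub (measurable_pi_apply b)) hN
  rw [← hΦmp.measure_preimage hB.nullMeasurableSet]
  have hpre : (Φ : SpT × ({m : κ // m ≠ a} → SpT) → (κ → SpT)) ⁻¹' {x : κ → SpT | x a - x b ∈ N} =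
      {z : SpT × ({m : κ // m ≠ a} → SpT) | z.1 - z.2 ⟨b, hab.symm⟩ ∈ N} := by
    ext ⟨t, x'⟩
    simp only [mem_preimage, mem_setOf_eq, hΦa]
    rw [show (Φ (t, x') : κ → SpT) b = x' ⟨b, hab.symm⟩ from hΦe t x' ⟨b, hab.symm⟩]
  have hS : MeasurableSet {z : SpT × ({m : κ // m ≠ a} → SpT) | z.1 - z.2 ⟨b, hab.symm⟩ ∈ N} :=
    measurableSet_preimage
      (measurable_fst.sub ((measurable_pi_apply (⟨b, hab.symm⟩ : {m : κ // m ≠ a})).comp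
        measurable_snd)) hN
  rw [hpre, Measure.volume_eq_prod, Measure.prod_apply_symm hS]
  have hsec : ∀ x' : {m : κ // m ≠ a} → SpT, volume ((fun t : SpT => (t, x')) ⁻¹'
      {z : SpT × ({m : κ // m ≠ a} → SpT) | z.1 - z.2 ⟨b, hab.symm⟩ ∈ N}) = 0 := by
    intro x'
    show volume ((fun t : SpT => t - x' ⟨b, hab.symm⟩) ⁻¹' N) = 0
    rw [(measurePreserving_sub_right volume (x' ⟨b, hab.symm⟩)).measure_preimage
      hN.nullMeasurableSet, hN0]
  calc ∫⁻ x', volume ((fun t : SpT => (t, x')) ⁻¹'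
        {z : SpT × ({m : κ // m ≠ a} → SpT) | z.1 - z.2 ⟨b, hab.symm⟩ ∈ N})
      = ∫⁻ _x' : {m : κ // m ≠ a} → SpT, (0 : ENNReal) := lintegral_congr hsec
    _ = 0 := lintegral_zero

/-! ### §2 F7j's Fubini computation with an almost-everywhere hypothesis -/

/-- **The Fubini step of the support argument, almost-everywhere form** (F7j's
`integral_prod_chiHat_mul_eq_zero` with its hypothesis weakened to a.e. `q`).  Let `χ_j ∈ L¹(ℝ × ℝ²)`,
signs `σ_j`, and `G ∈ L¹((κ → ℝ × ℝ²))`.  If `(∏_j χ_j(q_j)) · Ĝ_σ(q) = 0` for ALMOST every `q`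
(`Ĝ_σ(q) = ∫ (∏_j e^{iσ_j⟨q_j,u_j⟩_-}) G(u) du`), then `∫ (∏_j χ̂_j(σ_j(w_j - u_j))) G(u) du = 0` for
every `w`. [cite: FeldmanKnorrerTrubowitz2004Ladders, Lemma II.16, proof (p.13 L48–53), with Definition I.18 (p.8 L55–93) and §I.7 (p.8 L34–38)] -/
theorem integral_prod_chiHat_mul_eq_zero_of_ae {κ : Type*} [Fintype κ] (χ : κ → SpT → ℝ) (σ : κ → ℝ)
    (G : (κ → SpT) → ℂ) (hG : Integrable G) (hχ : ∀ j, Integrable (fun p : SpT => (χ j p : ℂ)))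
    (HC : ∀ᵐ q : κ → SpT, (∏ j, (χ j (q j) : ℂ)) *
        ∫ u : κ → SpT, (∏ j, Complex.exp (Complex.I * (σ j : ℂ) * (mink (q j) (u j) : ℂ))) * G u = 0)
    (w : κ → SpT) :
    ∫ u : κ → SpT, (∏ j, chiHat (χ j) (σ j • (w j - u j))) * G u = 0 := by
  set C : ℂ := (((2 * Real.pi) ^ (3 : ℕ) : ℂ)⁻¹) ^ Fintype.card κ with hC
  have hsplit : ∀ (q u : κ → SpT) (j : κ),
      Complex.exp (-(Complex.I * (mink (q j) (σ j • (w j - u j)) : ℂ))) =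
        Complex.exp (-(Complex.I * (σ j : ℂ) * (mink (q j) (w j) : ℂ))) *
          Complex.exp (Complex.I * (σ j : ℂ) * (mink (q j) (u j) : ℂ)) := by
    intro q u j
    rw [← Complex.exp_add, mink_smul_right, mink_sub_right]
    push_cast
    ring_nf
  -- Step 1: the product of the `χ̂_j` as ONE integral over `q : κ → SpT`
  have hprod : ∀ u : κ → SpT, (∏ j, chiHat (χ j) (σ j • (w j - u j))) =
      C * ∫ q : κ → SpT, ∏ j, (Complex.exp (-(Complex.I * (mink (q j) (σ j • (w j - u j)) : ℂ))) *
        (χ j (q j) : ℂ)) := by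
    intro u
    simp only [chiHat]
    rw [Finset.prod_mul_distrib, Finset.prod_const, Finset.card_univ, hC]
    congr 1
    exact (integral_fintype_prod_eq_prod (𝕜 := ℂ) (μ := fun _ => (volume : Measure SpT))
      (fun j (p : SpT) => Complex.exp (-(Complex.I * (mink p (σ j • (w j - u j)) : ℂ))) *
        (χ j p : ℂ))).symm
  -- Step 2: the integrand on the product space, and its integrability
  set Ψ : (κ → SpT) → (κ → SpT) → ℂ := fun u q =>
    (∏ j, Complex.exp (-(Complex.I * (mink (q j) (σ j • (w j - u j)) : ℂ))) * (χ j (q j) : ℂ)) * G u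
    with hΨdef
  have hΨ : ∀ u q, Ψ u q = (∏ j, Complex.exp (-(Complex.I * (σ j : ℂ) * (mink (q j) (w j) : ℂ)))) *
      (∏ j, Complex.exp (Complex.I * (σ j : ℂ) * (mink (q j) (u j) : ℂ))) *
        ((∏ j, (χ j (q j) : ℂ)) * G u) := by
    intro u q
    simp only [hΨdef, hsplit, Finset.prod_mul_distrib]
    ring
  have hX : Integrable (fun q : κ → SpT => ∏ j, (χ j (q j) : ℂ)) :=
    Integrable.fintype_prod (f := fun j (p : SpT) => (χ j p : ℂ)) (μ := fun _ => volume) hχ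
  have hint : Integrable (Function.uncurry Ψ) ((volume : Measure (κ → SpT)).prod volume) := by
    have h1 : Integrable (fun z : (κ → SpT) × (κ → SpT) => G z.1 * ∏ j, (χ j (z.2 j) : ℂ))
        ((volume : Measure (κ → SpT)).prod volume) := hG.mul_prod hX
    have hmeas : AEStronglyMeasurable (fun z : (κ → SpT) × (κ → SpT) =>
        (∏ j, Complex.exp (-(Complex.I * (σ j : ℂ) * (mink (z.2 j) (w j) : ℂ)))) *
          ∏ j, Complex.exp (Complex.I * (σ j : ℂ) * (mink (z.2 j) (z.1 j) : ℂ)))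
        ((volume : Measure (κ → SpT)).prod volume) := by
      refine Continuous.aestronglyMeasurable ?_
      refine Continuous.mul (continuous_finsetProd _ fun j _ => ?_)
        (continuous_finsetProd _ fun j _ => ?_) <;> fun_prop
    have h2 := h1.bdd_mul hmeas (c := 1) (ae_of_all _ fun z => by
      rw [norm_mul, norm_prod, norm_prod]
      simp [norm_cexp_I_mul_ofReal_mul_ofReal, norm_cexp_neg_I_mul_ofReal_mul_ofReal])
    refine h2.congr (ae_of_all _ fun z => ?_)
    show _ = Ψ z.1 z.2
    rw [hΨ]; ring
  -- Step 3: swap and factor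
  calc ∫ u : κ → SpT, (∏ j, chiHat (χ j) (σ j • (w j - u j))) * G u
      = ∫ u : κ → SpT, C * ∫ q : κ → SpT, Ψ u q := by
        refine integral_congr_ae (ae_of_all _ fun u => ?_)
        show (∏ j, chiHat (χ j) (σ j • (w j - u j))) * G u = C * ∫ q : κ → SpT, Ψ u q
        rw [hprod, mul_assoc, ← integral_mul_const]
    _ = C * ∫ u : κ → SpT, ∫ q : κ → SpT, Ψ u q := integral_const_mul C _
    _ = C * ∫ q : κ → SpT, ∫ u : κ → SpT, Ψ u q := by rw [integral_integral_swap hint]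
    _ = C * ∫ q : κ → SpT, (∏ j, Complex.exp (-(Complex.I * (σ j : ℂ) * (mink (q j) (w j) : ℂ)))) *
          ((∏ j, (χ j (q j) : ℂ)) *
            ∫ u : κ → SpT,
              (∏ j, Complex.exp (Complex.I * (σ j : ℂ) * (mink (q j) (u j) : ℂ))) * G u) := by
        congr 1
        refine integral_congr_ae (ae_of_all _ fun q => ?_)
        show ∫ u : κ → SpT, Ψ u q = _
        dsimp only
        rw [← integral_const_mul, ← integral_const_mul]
        refine integral_congr_ae (ae_of_all _ fun u => ?_)
        show Ψ u q = _
        dsimp only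
        rw [hΨ]; ring
    _ = C * ∫ q : κ → SpT, (0 : ℂ) := by
        congr 1
        refine integral_congr_ae ?_
        filter_upwards [HC] with q hq
        rw [hq, mul_zero]
    _ = 0 := by simp

/-! ### §3 Two free position legs: the partial `χ̂`-convolution vanishes for almost every free difference -/

/-- **Two free position legs — the heart of the case `|P ∖ chg| = 2`.**  Let `π ≠ π'` be position legs
that are NOT convolved, `chg ≃ P ∖ {π, π'}` the convolved legs (new labels `s`, new scales), `ν ∈ chg`
a leg with `s_ν ∈ Σ_new(ν)` whose new and old extended sectors are disjoint, `f` sectorized at the old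
scales and translation invariant with integrable pinned sections, and `Φ` the insertion equivalence
writing a slice vector at `π` as (position `d` of leg `π'`, positions `v` of the convolved legs).  Then
for ALMOST EVERY `d`, the `χ̂`-convolution in the convolved legs of the section
`v ↦ f|_i(legIns k π 0 (Φ(d, v)); s')` vanishes for every `w`.  Proof: for fixed momenta `q` of the
convolved legs with `q_ν ∉ s̃'_ν`, the partial phase transform `d ↦ ∫ e^{iΣσ_j⟨q_j,v_j⟩} f(…(d,v)…) dv`
is integrable and all its `⟨·,·⟩_-`-Fourier coefficients in `d` are transforms pinned at `π`, which
vanish by sectorization (F7m's `pinFT_eq_zero_of_not_mem_extSector'`); by uniqueness of the Fourier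
transform on `L¹(ℝ × ℝ²)` it vanishes for a.e. `d`; a Tonelli exchange (the product
`(∏ χ_{s_j}(q_j)) × (partial transform)` is a.e.-strongly measurable on `(q, d)`-space and vanishes for
every `q` at a.e. `d`) makes the exceptional `d`-set independent of `q`, and the almost-everywhere form
of F7j's Fubini computation (§2) concludes.
[cite: FeldmanKnorrerTrubowitz2004Ladders, Lemma II.16, proof (p.13 L48–53), with Definitions I.5 (ii) (p.5 L95–108), I.6 (p.5 L110–128), I.18 (p.8 L55–93)] -/
theorem ae_forall_integral_prod_chiHat_twoFree (D : LadderData) (hD : D.Admissible)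
    {jl jr jl' jr' : ℕ} {i : LegKind} {f : FourLegFn} (hsec : IsSectorized D.S D.e D.fr jl jr f)
    (htr : IsTranslationInvariant f) (s s' : Fin 4 → Arc) (chg : Fin 4 → Prop) [DecidablePred chg]
    {π π' : Fin 4} (hπ : i π = 1) (hπ' : i π' = 1) (hππ' : π ≠ π')
    (hchg : ∀ μ, chg μ ↔ (i μ = 1 ∧ μ ≠ π ∧ μ ≠ π'))
    {ν : Fin 4} (hν : chg ν) (h1ν : 1 ≤ (if ν.val < 2 then jl' else jr'))
    (hsν : s ν ∈ D.Sig (if ν.val < 2 then jl' else jr'))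
    (hdisj : extSector D.S D.e D.fr (if ν.val < 2 then jl' else jr') (s ν) ∩
        extSector D.S D.e D.fr (if ν.val < 2 then jl else jr) (s' ν) = ∅)
    (k : Fin 4 → SpT)
    (hint : ∀ (k' : Fin 4 → SpT) (π₀ : Fin 4), i π₀ = 1 → (∀ μ, ¬ i μ = 1 → k' μ = k μ) →
      Integrable fun u : {μ : Fin 4 // i μ = 1 ∧ μ ≠ π₀} → SpT => f i (legIns i k' π₀ 0 u) s')
    (Φ : SpT × ({μ : Fin 4 // chg μ} → SpT) ≃ᵐ ({μ : Fin 4 // i μ = 1 ∧ μ ≠ π} → SpT))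
    (hΦmp : MeasurePreserving Φ volume volume)
    (hΦa : ∀ (d : SpT) (v : {μ : Fin 4 // chg μ} → SpT), Φ (d, v) ⟨π', hπ', hππ'.symm⟩ = d)
    (hΦe : ∀ (d : SpT) (v : {μ : Fin 4 // chg μ} → SpT) (j : {μ : Fin 4 // chg μ}),
      Φ (d, v) ⟨j.1, ((hchg j.1).1 j.2).1, ((hchg j.1).1 j.2).2.1⟩ = v j) :
    ∀ᵐ d : SpT, ∀ w : {μ : Fin 4 // chg μ} → SpT,
      ∫ v : ({μ : Fin 4 // chg μ} → SpT),
        (∏ j : {μ : Fin 4 // chg μ}, chiHat (D.χ (if j.1.val < 2 then jl' else jr') (s j.1))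
            (((-1 : ℝ) ^ bExp j.1) • (w j - v j))) * f i (legIns i k π 0 (Φ (d, v))) s' = 0 := by
  classical
  haveI := isAddHaarMeasure_volume_SpT'
  -- Step 0: a non-integrable cut-off has `χ̂ ≡ 0`
  by_cases hχ : ∀ j : {μ : Fin 4 // chg μ}, Integrable fun p : SpT =>
      ((D.χ (if j.1.val < 2 then jl' else jr') (s j.1) p : ℝ) : ℂ)
  swap
  · obtain ⟨j, hj⟩ := not_forall.1 hχ
    have h0 : ∀ x, chiHat (D.χ (if j.1.val < 2 then jl' else jr') (s j.1)) x = 0 :=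
      chiHat_eq_zero_of_not_integrable _ hj
    refine ae_of_all _ fun d w => ?_
    refine integral_eq_zero_of_ae (ae_of_all _ fun v => ?_)
    simp only [Pi.zero_apply]
    rw [Finset.prod_eq_zero (Finset.mem_univ j) (h0 _), zero_mul]
  -- notation
  set χ : {μ : Fin 4 // chg μ} → SpT → ℝ := fun j => D.χ (if j.1.val < 2 then jl' else jr') (s j.1)
    with hχdef
  set σ : {μ : Fin 4 // chg μ} → ℝ := fun j => (-1 : ℝ) ^ bExp j.1 with hσdef
  set G : ({μ : Fin 4 // i μ = 1 ∧ μ ≠ π} → SpT) → ℂ := fun u => f i (legIns i k π 0 u) s' with hGdef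
  have hG : Integrable G := hint k π hπ fun _ _ => rfl
  set F : SpT × ({μ : Fin 4 // chg μ} → SpT) → ℂ := fun z => G (Φ z) with hFdef
  have hF : Integrable F ((volume : Measure SpT).prod volume) := by
    have := (hΦmp.integrable_comp_emb Φ.measurableEmbedding).2 hG
    rwa [Measure.volume_eq_prod] at this
  -- the enumeration of the slice legs at `π` other than `π'` by the convolved legs
  set a : {μ : Fin 4 // i μ = 1 ∧ μ ≠ π} := ⟨π', hπ', hππ'.symm⟩ with ha
  let ε : {μ : Fin 4 // chg μ} ≃ {m : {μ : Fin 4 // i μ = 1 ∧ μ ≠ π} // m ≠ a} :=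
    { toFun := fun j => ⟨⟨j.1, ((hchg j.1).1 j.2).1, ((hchg j.1).1 j.2).2.1⟩,
        fun h => ((hchg j.1).1 j.2).2.2 (congrArg (fun m : {μ : Fin 4 // i μ = 1 ∧ μ ≠ π} => m.1) h)⟩
      invFun := fun m => ⟨m.1.1, (hchg m.1.1).2 ⟨m.1.2.1, m.1.2.2, fun h => m.2 (Subtype.ext h)⟩⟩
      left_inv := fun j => rfl
      right_inv := fun m => rfl }
  -- the phase kernel of the convolved legs
  set E : ({μ : Fin 4 // chg μ} → SpT) → ({μ : Fin 4 // chg μ} → SpT) → ℂ := fun q v =>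
    ∏ j, Complex.exp (Complex.I * ((σ j : ℝ) : ℂ) * (mink (q j) (v j) : ℂ)) with hEdef
  have hEnorm : ∀ q v, ‖E q v‖ = 1 := by
    intro q v
    rw [hEdef]
    simp only [norm_prod, norm_cexp_I_mul_ofReal_mul_ofReal, Finset.prod_const_one]
  have hEcont : Continuous fun z : ({μ : Fin 4 // chg μ} → SpT) × ({μ : Fin 4 // chg μ} → SpT) =>
      E z.1 z.2 := by
    rw [hEdef]
    exact continuous_finsetProd _ fun j _ => by fun_prop
  have hEF : ∀ q, Integrable (fun z : SpT × ({μ : Fin 4 // chg μ} → SpT) => E q z.2 * F z)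
      ((volume : Measure SpT).prod volume) := by
    intro q
    refine hF.bdd_mul (c := 1) ?_ (ae_of_all _ fun z => (hEnorm q z.2).le)
    exact (hEcont.comp (continuous_const.prodMk continuous_snd)).aestronglyMeasurable
  -- (2b) for `q_ν` outside the old sector the partial transform `d ↦ ∫ E(q,v) F(d,v) dv` is a.e. zero
  have hΨae : ∀ q : {μ : Fin 4 // chg μ} → SpT,
      q ⟨ν, hν⟩ ∉ extSector D.S D.e D.fr (if ν.val < 2 then jl else jr) (s' ν) →
      (fun d : SpT => ∫ v, E q v * F (d, v)) =ᵐ[volume] 0 := by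
    intro q hqν
    refine ae_eq_zero_of_forall_integral_mink_eq_zero (hEF q).integral_prod_left
      (c := (-1 : ℝ) ^ bExp π') (pow_ne_zero _ (by norm_num)) fun p => ?_
    -- momenta: `p` at `π'`, `q` on the convolved legs, `k` on the momentum legs, conservation at `π`
    set k'' : Fin 4 → SpT := fun μ => if h : chg μ then q ⟨μ, h⟩ else if μ = π' then p else k μ
      with hk''def
    set k' : Fin 4 → SpT := Function.update k'' π
      (-(((-1 : ℝ) ^ bExp π) • ∑ μ ∈ Finset.univ.erase π, ((-1 : ℝ) ^ bExp μ) • k'' μ)) with hk'def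
    have hk' : k' 0 - k' 1 - k' 2 + k' 3 = 0 := surface_update_conserved π k''
    have hk'mom : ∀ μ, ¬ i μ = 1 → k' μ = k μ := by
      intro μ hμ
      have hμπ : μ ≠ π := fun h => hμ (h ▸ hπ)
      have hμπ' : μ ≠ π' := fun h => hμ (h ▸ hπ')
      have hμc : ¬ chg μ := fun h => hμ ((hchg μ).1 h).1
      rw [hk'def, Function.update_of_ne hμπ, hk''def]
      simp only [dif_neg hμc, if_neg hμπ']
    have hk'q : ∀ j : {μ : Fin 4 // chg μ}, k' j.1 = q j := by
      intro j
      have hjπ : j.1 ≠ π := ((hchg j.1).1 j.2).2.1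
      rw [hk'def, Function.update_of_ne hjπ, hk''def]
      simp only [dif_pos j.2]
    have hk'π' : k' π' = p := by
      have hc : ¬ chg π' := fun h => ((hchg π').1 h).2.2 rfl
      rw [hk'def, Function.update_of_ne hππ'.symm, hk''def]
      simp only [dif_neg hc, if_true]
    have hzero := pinFT_eq_zero_of_not_mem_extSector' D.S D.e D.fr hsec htr s' k' hk' hπ
      (fun π₀ h₀ => hint k' π₀ h₀ hk'mom) ((hchg ν).1 hν).1 (by rw [hk'q ⟨ν, hν⟩]; exact hqν)
    -- the integrand transported to the slice at `π`
    set H : ({μ : Fin 4 // i μ = 1 ∧ μ ≠ π} → SpT) → ℂ := fun u =>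
      Complex.exp (Complex.I * (((-1 : ℝ) ^ bExp π' : ℝ) : ℂ) * (mink p (u a) : ℂ)) *
        (E q (fun j => u (ε j).1) * G u) with hHdef
    have hHΦ : ∀ (d : SpT) (v : {μ : Fin 4 // chg μ} → SpT), H (Φ (d, v)) =
        Complex.exp (Complex.I * (((-1 : ℝ) ^ bExp π' : ℝ) : ℂ) * (mink p d : ℂ)) *
          (E q v * F (d, v)) := by
      intro d v
      have hv : (fun j => Φ (d, v) (ε j).1) = v := funext fun j => hΦe d v j
      rw [hHdef]
      beta_reduce
      rw [show Φ (d, v) a = d from hΦa d v, hv]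
    have hint2 : Integrable (fun z : SpT × ({μ : Fin 4 // chg μ} → SpT) =>
        Complex.exp (Complex.I * (((-1 : ℝ) ^ bExp π' : ℝ) : ℂ) * (mink p z.1 : ℂ)) * (E q z.2 * F z))
        ((volume : Measure SpT).prod volume) := by
      refine (hEF q).bdd_mul (c := 1) ?_ (ae_of_all _ fun z => ?_)
      · refine Continuous.aestronglyMeasurable ?_
        fun_prop
      · exact (norm_cexp_I_mul_ofReal_mul_ofReal _ _).le
    have hsplit : ∀ u : {μ : Fin 4 // i μ = 1 ∧ μ ≠ π} → SpT, H u =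
        (∏ m : {μ : Fin 4 // i μ = 1 ∧ μ ≠ π}, legPhase m.1 (k' m.1) (u m)) *
          f i (legIns i k' π 0 u) s' := by
      intro u
      have h1 : Complex.exp (Complex.I * (((-1 : ℝ) ^ bExp π' : ℝ) : ℂ) * (mink p (u a) : ℂ)) =
          legPhase a.1 (k' a.1) (u a) := by
        rw [legPhase]
        show _ = Complex.exp (Complex.I * (-1 : ℂ) ^ bExp π' * (mink (k' π') (u a) : ℂ))
        rw [hk'π']
        push_cast
        ring_nf
      have h2 : E q (fun j => u (ε j).1) =
          ∏ j : {μ : Fin 4 // chg μ}, legPhase (ε j).1.1 (k' (ε j).1.1) (u (ε j).1) := by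
        rw [hEdef]
        refine Finset.prod_congr rfl fun j _ => ?_
        show Complex.exp (Complex.I * ((σ j : ℝ) : ℂ) * (mink (q j) (u (ε j).1) : ℂ)) =
          Complex.exp (Complex.I * (-1 : ℂ) ^ bExp j.1 * (mink (k' j.1) (u (ε j).1) : ℂ))
        rw [hσdef, hk'q j]
        push_cast
        ring_nf
      have h3 : G u = f i (legIns i k' π 0 u) s' := by
        rw [hGdef]
        exact congrArg (fun z => f i z s') (legIns_congr_mom i (fun μ hμ => (hk'mom μ hμ).symm) π 0 u)
      rw [hHdef]
      beta_reduce
      rw [h1, h2, h3, prod_eq_mul_prod_equiv (M := ℂ) a ε (fun m => legPhase m.1 (k' m.1) (u m))]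
      ring
    calc ∫ d : SpT, Complex.exp (Complex.I * (((-1 : ℝ) ^ bExp π' : ℝ) : ℂ) * (mink p d : ℂ)) *
          ∫ v, E q v * F (d, v)
        = ∫ d : SpT, ∫ v, Complex.exp (Complex.I * (((-1 : ℝ) ^ bExp π' : ℝ) : ℂ) * (mink p d : ℂ)) *
            (E q v * F (d, v)) :=
          integral_congr_ae (ae_of_all _ fun d => (integral_const_mul _ _).symm)
      _ = ∫ z : SpT × ({μ : Fin 4 // chg μ} → SpT),
            Complex.exp (Complex.I * (((-1 : ℝ) ^ bExp π' : ℝ) : ℂ) * (mink p z.1 : ℂ)) *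
              (E q z.2 * F z) ∂((volume : Measure SpT).prod volume) := (integral_prod _ hint2).symm
      _ = ∫ z : SpT × ({μ : Fin 4 // chg μ} → SpT), H (Φ z) ∂((volume : Measure SpT).prod volume) := by
          refine integral_congr_ae (ae_of_all _ fun z => ?_)
          show _ = H (Φ (z.1, z.2))
          rw [hHΦ]
      _ = ∫ u, H u := by rw [← Measure.volume_eq_prod]; exact hΦmp.integral_comp' H
      _ = ∫ u, (∏ m : {μ : Fin 4 // i μ = 1 ∧ μ ≠ π}, legPhase m.1 (k' m.1) (u m)) *
            f i (legIns i k' π 0 u) s' := integral_congr_ae (ae_of_all _ hsplit)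
      _ = 0 := hzero
  -- (2c) the product `(∏ χ(q_j)) × (partial transform)` vanishes a.e. on `(q, d)`-space
  set Ξ : ({μ : Fin 4 // chg μ} → SpT) × SpT → ℂ := fun y =>
    (∏ j, ((χ j) (y.1 j) : ℂ)) * ∫ v, E y.1 v * F (y.2, v) with hΞdef
  have hX : Integrable (fun q : {μ : Fin 4 // chg μ} → SpT => ∏ j, ((χ j) (q j) : ℂ)) :=
    Integrable.fintype_prod (f := fun j (p : SpT) => (χ j p : ℂ)) (μ := fun _ => volume) hχ
  have hθ : Measure.QuasiMeasurePreserving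
      (fun w : (({μ : Fin 4 // chg μ} → SpT) × SpT) × ({μ : Fin 4 // chg μ} → SpT) => (w.1.2, w.2))
      (((volume : Measure ({μ : Fin 4 // chg μ} → SpT)).prod (volume : Measure SpT)).prod volume)
      ((volume : Measure SpT).prod volume) :=
    (Measure.quasiMeasurePreserving_snd).comp
      (measurePreserving_prodAssoc (volume : Measure ({μ : Fin 4 // chg μ} → SpT))
        (volume : Measure SpT) (volume : Measure ({μ : Fin 4 // chg μ} → SpT))).quasiMeasurePreserving
  have hFθ : AEStronglyMeasurable
      (fun w : (({μ : Fin 4 // chg μ} → SpT) × SpT) × ({μ : Fin 4 // chg μ} → SpT) => F (w.1.2, w.2))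
      (((volume : Measure ({μ : Fin 4 // chg μ} → SpT)).prod (volume : Measure SpT)).prod volume) :=
    hF.1.comp_quasiMeasurePreserving hθ
  have hf₃ : AEStronglyMeasurable
      (fun w : (({μ : Fin 4 // chg μ} → SpT) × SpT) × ({μ : Fin 4 // chg μ} → SpT) =>
        E w.1.1 w.2 * F (w.1.2, w.2))
      (((volume : Measure ({μ : Fin 4 // chg μ} → SpT)).prod (volume : Measure SpT)).prod volume) := by
    refine AEStronglyMeasurable.mul ?_ hFθ
    exact (hEcont.comp ((continuous_fst.comp continuous_fst).prodMk continuous_snd)).aestronglyMeasurable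
  have hΞm : AEStronglyMeasurable Ξ
      ((volume : Measure ({μ : Fin 4 // chg μ} → SpT)).prod (volume : Measure SpT)) := by
    rw [hΞdef]
    exact (hX.1.comp_fst).mul hf₃.integral_prod_right'
  have hΞpt : ∀ q : {μ : Fin 4 // chg μ} → SpT, ∀ᵐ d : SpT, Ξ (q, d) = 0 := by
    intro q
    by_cases hq : ∃ j : {μ : Fin 4 // chg μ}, χ j (q j) = 0
    · obtain ⟨j, hj⟩ := hq
      refine ae_of_all _ fun d => ?_
      rw [hΞdef]
      beta_reduce
      rw [Finset.prod_eq_zero (Finset.mem_univ j) (by rw [hj]; simp), zero_mul]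
    · have hq' : ∀ j : {μ : Fin 4 // chg μ}, χ j (q j) ≠ 0 := fun j hj => hq ⟨j, hj⟩
      have hνnew : q ⟨ν, hν⟩ ∈ extSector D.S D.e D.fr (if ν.val < 2 then jl' else jr') (s ν) :=
        hD.chi_support _ h1ν _ hsν (hq' ⟨ν, hν⟩)
      have hνold : q ⟨ν, hν⟩ ∉ extSector D.S D.e D.fr (if ν.val < 2 then jl else jr) (s' ν) := by
        intro hB
        have : q ⟨ν, hν⟩ ∈ extSector D.S D.e D.fr (if ν.val < 2 then jl' else jr') (s ν) ∩
            extSector D.S D.e D.fr (if ν.val < 2 then jl else jr) (s' ν) := ⟨hνnew, hB⟩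
        rw [hdisj] at this
        exact this
      filter_upwards [hΨae q hνold] with d hd
      rw [hΞdef]
      beta_reduce
      rw [hd, Pi.zero_apply, mul_zero]
  have hΞ0 : Ξ =ᵐ[(volume : Measure ({μ : Fin 4 // chg μ} → SpT)).prod (volume : Measure SpT)] 0 :=
    ae_prod_eq_zero_of_forall_ae hΞm hΞpt
  -- (2d)–(2e) swap the order, add integrability of a.e. section, and conclude with §2
  have hswap : ∀ᵐ d : SpT, ∀ᵐ q : {μ : Fin 4 // chg μ} → SpT, Ξ (q, d) = 0 :=
    ae_ae_swap_of_ae_prod hΞ0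
  have hFd : ∀ᵐ d : SpT, Integrable (fun v : {μ : Fin 4 // chg μ} → SpT => F (d, v)) :=
    hF.prod_right_ae
  filter_upwards [hswap, hFd] with d hd1 hd2
  intro w
  have hd1' : ∀ᵐ q : {μ : Fin 4 // chg μ} → SpT, (∏ j, ((χ j) (q j) : ℂ)) *
      ∫ u : {μ : Fin 4 // chg μ} → SpT,
        (∏ j, Complex.exp (Complex.I * ((σ j : ℝ) : ℂ) * (mink (q j) (u j) : ℂ))) * F (d, u) = 0 := by
    filter_upwards [hd1] with q hq
    rw [hΞdef] at hq
    exact hq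
  exact integral_prod_chiHat_mul_eq_zero_of_ae χ σ (fun v => F (d, v)) hd2 hχ hd1' w

/-! ### §4 The support step, case `|P ∖ chg| = 2`: almost everywhere on every slice -/

/-- **Support step, case `|P ∖ chg| = 2`: one side changes scale, the other side has two position legs
`π ≠ π'`** (the one-sided patterns of Lemma II.16 on the six (component, side) pairs with an
all-position fixed side).  For admissible ladder data, `f` sectorized at `(jl, jr)` and translation
invariant with integrable pinned sections, convolved legs `chg ≃ P ∖ {π, π'}` (new labels `s` at the new
scales), and a convolved leg `ν` with `s_ν ∈ Σ_new(ν)` whose new and old extended sectors are disjoint,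
the `s'`-summand of the resectorisation
`y ↦ ∫ (∏_{μ ∈ chg} χ̂_{s_μ}((-1)^{b_μ}(y_μ - x'_μ))) f|_i(x' on chg, y elsewhere; s') dx'`
vanishes at ALMOST EVERY point of EVERY slice of the `L¹–L^∞` norm (momentum legs frozen at `k`,
position leg `μ₀` frozen at `x₀`, the other position legs free) — which is what the norm bound uses.
It does NOT vanish identically for the `f` quantified over: translating by `y_π` writes the summand as
a momentum-leg phase times the partial convolution of §3 at the free difference `y_{π'} - y_π`, which
vanishes off a null set of differences; and the difference of two free slice coordinates (or a free
coordinate minus the frozen one) almost never lies in a null set (§1).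
[cite: FeldmanKnorrerTrubowitz2004Ladders, Lemma II.16, proof (p.13 L48–53), with Definitions I.10 (p.6 L117–128), I.18 (p.8 L55–93)] -/
theorem ae_integral_resect_eq_zero_of_disjoint_twoFree (D : LadderData) (hD : D.Admissible)
    {jl jr jl' jr' : ℕ} {i : LegKind} {f : FourLegFn} (hsec : IsSectorized D.S D.e D.fr jl jr f)
    (htr : IsTranslationInvariant f) (s s' : Fin 4 → Arc) (chg : Fin 4 → Prop) [DecidablePred chg]
    {π π' : Fin 4} (hπ : i π = 1) (hπ' : i π' = 1) (hππ' : π ≠ π')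
    (hchg : ∀ μ, chg μ ↔ (i μ = 1 ∧ μ ≠ π ∧ μ ≠ π'))
    {ν : Fin 4} (hν : chg ν) (h1ν : 1 ≤ (if ν.val < 2 then jl' else jr'))
    (hsν : s ν ∈ D.Sig (if ν.val < 2 then jl' else jr'))
    (hdisj : extSector D.S D.e D.fr (if ν.val < 2 then jl' else jr') (s ν) ∩
        extSector D.S D.e D.fr (if ν.val < 2 then jl else jr) (s' ν) = ∅)
    (hint : ∀ (k : Fin 4 → SpT) (π₀ : Fin 4), i π₀ = 1 →
      Integrable fun u : {μ : Fin 4 // i μ = 1 ∧ μ ≠ π₀} → SpT => f i (legIns i k π₀ 0 u) s')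
    (k : Fin 4 → SpT) (μ₀ : Fin 4) (hμ₀ : i μ₀ = 1) (x₀ : SpT) :
    ∀ᵐ x : ({μ : Fin 4 // i μ = 1 ∧ μ ≠ μ₀} → SpT),
      ∫ x' : ({μ : Fin 4 // chg μ} → SpT),
        (∏ j : {μ : Fin 4 // chg μ}, chiHat (D.χ (if j.1.val < 2 then jl' else jr') (s j.1))
            (((-1 : ℝ) ^ bExp j.1) • (legIns i k μ₀ x₀ x j.1 - x' j))) *
          f i (fun μ => if h : chg μ then x' ⟨μ, h⟩ else legIns i k μ₀ x₀ x μ) s' = 0 := by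
  classical
  haveI := isAddHaarMeasure_volume_SpT'
  haveI := isNegInvariant_volume_SpT'
  haveI := isAddRightInvariant_volume_pi_SpT'' (κ := {μ : Fin 4 // chg μ})
  -- the insertion equivalence at `π'` over the slice legs at `π`
  set a : {μ : Fin 4 // i μ = 1 ∧ μ ≠ π} := ⟨π', hπ', hππ'.symm⟩ with ha
  let ε : {μ : Fin 4 // chg μ} ≃ {m : {μ : Fin 4 // i μ = 1 ∧ μ ≠ π} // m ≠ a} :=
    { toFun := fun j => ⟨⟨j.1, ((hchg j.1).1 j.2).1, ((hchg j.1).1 j.2).2.1⟩,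
        fun h => ((hchg j.1).1 j.2).2.2 (congrArg (fun m : {μ : Fin 4 // i μ = 1 ∧ μ ≠ π} => m.1) h)⟩
      invFun := fun m => ⟨m.1.1, (hchg m.1.1).2 ⟨m.1.2.1, m.1.2.2, fun h => m.2 (Subtype.ext h)⟩⟩
      left_inv := fun j => rfl
      right_inv := fun m => rfl }
  obtain ⟨Φ, hΦmp, hΦa, hΦe, -⟩ := exists_measurableEquiv_insert' (X := SpT) a ε
  have hΦe' : ∀ (d : SpT) (v : {μ : Fin 4 // chg μ} → SpT) (j : {μ : Fin 4 // chg μ}),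
      Φ (d, v) ⟨j.1, ((hchg j.1).1 j.2).1, ((hchg j.1).1 j.2).2.1⟩ = v j := fun d v j => hΦe d v j
  -- Step 2 (§3): the partial convolution vanishes for a.e. free difference
  have hae := ae_forall_integral_prod_chiHat_twoFree D hD hsec htr s s' chg hπ hπ' hππ' hchg hν h1ν
    hsν hdisj k (fun k' π₀ h₀ _ => hint k' π₀ h₀) Φ hΦmp (fun d v => hΦa d v) hΦe'
  -- Step 1: the summand on the slice is a momentum-leg phase times that partial convolution
  have hT : ∀ x : {μ : Fin 4 // i μ = 1 ∧ μ ≠ μ₀} → SpT,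
      ∫ x' : ({μ : Fin 4 // chg μ} → SpT),
        (∏ j : {μ : Fin 4 // chg μ}, chiHat (D.χ (if j.1.val < 2 then jl' else jr') (s j.1))
            (((-1 : ℝ) ^ bExp j.1) • (legIns i k μ₀ x₀ x j.1 - x' j))) *
          f i (fun μ => if h : chg μ then x' ⟨μ, h⟩ else legIns i k μ₀ x₀ x μ) s' =
      (∏ μ : Fin 4, if i μ = 0 then legPhase μ (k μ) (legIns i k μ₀ x₀ x π) else 1) *
        ∫ v : ({μ : Fin 4 // chg μ} → SpT),
          (∏ j : {μ : Fin 4 // chg μ}, chiHat (D.χ (if j.1.val < 2 then jl' else jr') (s j.1))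
              (((-1 : ℝ) ^ bExp j.1) • ((legIns i k μ₀ x₀ x j.1 - legIns i k μ₀ x₀ x π) - v j))) *
            f i (legIns i k π 0 (Φ (legIns i k μ₀ x₀ x π' - legIns i k μ₀ x₀ x π, v))) s' := by
    intro x
    set y : Fin 4 → SpT := legIns i k μ₀ x₀ x with hy
    set c : SpT := y π with hc
    have hymom : ∀ μ, ¬ i μ = 1 → y μ = k μ := fun μ hμ =>
      legIns_apply_of_mom i k μ₀ x₀ x hμ (fun h => hμ (h ▸ hμ₀))
    have hV : ∀ x' : {μ : Fin 4 // chg μ} → SpT,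
        (fun μ => if h : chg μ then x' ⟨μ, h⟩ else y μ) =
          translate i c (legIns i k π 0 (Φ (y π' - c, x' - fun _ => c))) := by
      intro x'
      funext μ
      by_cases hμ : chg μ
      · have h1 : i μ = 1 := ((hchg μ).1 hμ).1
        have hμπ : μ ≠ π := ((hchg μ).1 hμ).2.1
        have h0 : ¬ i μ = 0 := by omega
        rw [dif_pos hμ]
        simp only [translate, if_neg h0, legIns_apply_of_pos i k π 0 _ ⟨h1, hμπ⟩]
        rw [hΦe' (y π' - c) (x' - fun _ => c) ⟨μ, hμ⟩]
        simp
      · rw [dif_neg hμ]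
        by_cases hμπ : μ = π
        · subst hμπ
          have h0 : ¬ i μ = 0 := by omega
          simp only [translate, if_neg h0, legIns_apply_self, zero_add, hc]
        · by_cases hμπ' : μ = π'
          · subst hμπ'
            have h0 : ¬ i μ = 0 := by omega
            simp only [translate, if_neg h0, legIns_apply_of_pos i k π 0 _ ⟨hπ', hμπ⟩]
            rw [show Φ (y μ - c, x' - fun _ => c) ⟨μ, hπ', hμπ⟩ = y μ - c from hΦa _ _]
            simp
          · have h1 : ¬ i μ = 1 := fun h => hμ ((hchg μ).2 ⟨h, hμπ, hμπ'⟩)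
            have h0 : i μ = 0 := by omega
            simp only [translate, if_pos h0, legIns_apply_of_mom i k π 0 _ h1 hμπ, hymom μ h1]
    have hf : ∀ x' : {μ : Fin 4 // chg μ} → SpT,
        f i (fun μ => if h : chg μ then x' ⟨μ, h⟩ else y μ) s' =
          (∏ μ : Fin 4, if i μ = 0 then legPhase μ (k μ) c else 1) *
            f i (legIns i k π 0 (Φ (y π' - c, x' - fun _ => c))) s' := by
      intro x'
      rw [hV x', htr.1 i c _ s']
      congr 1
      exact prod_momPhase_congr i _ k c fun μ hμ =>
        legIns_apply_of_mom i k π 0 _ (by omega) (fun h => by rw [h] at hμ; omega)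
    set H : ({μ : Fin 4 // chg μ} → SpT) → ℂ := fun v =>
      (∏ j : {μ : Fin 4 // chg μ}, chiHat (D.χ (if j.1.val < 2 then jl' else jr') (s j.1))
          (((-1 : ℝ) ^ bExp j.1) • ((y j.1 - c) - v j))) *
        f i (legIns i k π 0 (Φ (y π' - c, v))) s' with hH
    have hintegrand : ∀ x' : {μ : Fin 4 // chg μ} → SpT,
        (∏ j : {μ : Fin 4 // chg μ}, chiHat (D.χ (if j.1.val < 2 then jl' else jr') (s j.1))
            (((-1 : ℝ) ^ bExp j.1) • (y j.1 - x' j))) *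
          f i (fun μ => if h : chg μ then x' ⟨μ, h⟩ else y μ) s' =
        (∏ μ : Fin 4, if i μ = 0 then legPhase μ (k μ) c else 1) * H (x' - fun _ => c) := by
      intro x'
      rw [hf x', hH]
      simp only [Pi.sub_apply, sub_sub_sub_cancel_right]
      ring
    simp_rw [hintegrand]
    rw [integral_const_mul, integral_sub_right_eq_self H (fun _ : {μ : Fin 4 // chg μ} => c)]
  -- Step 3: the free difference `y_{π'} - y_π` on the slice almost never lies in a null set
  have hdmeas : Measurable fun x : {μ : Fin 4 // i μ = 1 ∧ μ ≠ μ₀} → SpT =>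
      legIns i k μ₀ x₀ x π' - legIns i k μ₀ x₀ x π :=
    ((measurable_pi_apply π').comp (measurable_legIns i k μ₀ x₀)).sub
      ((measurable_pi_apply π).comp (measurable_legIns i k μ₀ x₀))
  have hnull : ∀ N : Set SpT, MeasurableSet N → volume N = 0 →
      volume ((fun x : {μ : Fin 4 // i μ = 1 ∧ μ ≠ μ₀} → SpT =>
        legIns i k μ₀ x₀ x π' - legIns i k μ₀ x₀ x π) ⁻¹' N) = 0 := by
    intro N hN hN0
    by_cases h1 : μ₀ = π
    · have hπ'μ₀ : π' ≠ μ₀ := fun h => hππ' (h.trans h1).symm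
      have hA : volume ((fun t : SpT => t - x₀) ⁻¹' N) = 0 := by
        rw [(measurePreserving_sub_right volume x₀).measure_preimage hN.nullMeasurableSet, hN0]
      have hset : (fun x : {μ : Fin 4 // i μ = 1 ∧ μ ≠ μ₀} → SpT =>
          legIns i k μ₀ x₀ x π' - legIns i k μ₀ x₀ x π) ⁻¹' N =
          {x | x ⟨π', hπ', hπ'μ₀⟩ ∈ (fun t : SpT => t - x₀) ⁻¹' N} := by
        ext x
        have hyπ : legIns i k μ₀ x₀ x π = x₀ := by
          rw [← h1]; exact legIns_apply_self i k μ₀ x₀ x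
        simp only [mem_preimage, mem_setOf_eq, hyπ, legIns_apply_of_pos i k μ₀ x₀ x ⟨hπ', hπ'μ₀⟩]
      rw [hset]
      exact volume_eval_mem_null _ hA
    · by_cases h2 : μ₀ = π'
      · have hπμ₀ : π ≠ μ₀ := fun h => hππ' (h.trans h2)
        have hmp : MeasurePreserving (fun t : SpT => x₀ - t) volume volume := by
          have hcomp := (Measure.measurePreserving_neg (volume : Measure SpT)).comp
            (measurePreserving_sub_right volume x₀)
          have heq : (fun t : SpT => x₀ - t) = (Neg.neg ∘ fun t : SpT => t - x₀) := by
            funext t; simp [neg_sub]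
          rw [heq]
          exact hcomp
        have hA : volume ((fun t : SpT => x₀ - t) ⁻¹' N) = 0 := by
          rw [hmp.measure_preimage hN.nullMeasurableSet, hN0]
        have hset : (fun x : {μ : Fin 4 // i μ = 1 ∧ μ ≠ μ₀} → SpT =>
            legIns i k μ₀ x₀ x π' - legIns i k μ₀ x₀ x π) ⁻¹' N =
            {x | x ⟨π, hπ, hπμ₀⟩ ∈ (fun t : SpT => x₀ - t) ⁻¹' N} := by
          ext x
          have hyπ' : legIns i k μ₀ x₀ x π' = x₀ := by
            rw [← h2]; exact legIns_apply_self i k μ₀ x₀ x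
          simp only [mem_preimage, mem_setOf_eq, hyπ', legIns_apply_of_pos i k μ₀ x₀ x ⟨hπ, hπμ₀⟩]
        rw [hset]
        exact volume_eval_mem_null _ hA
      · have hπμ₀ : π ≠ μ₀ := fun h => h1 h.symm
        have hπ'μ₀ : π' ≠ μ₀ := fun h => h2 h.symm
        have hset : (fun x : {μ : Fin 4 // i μ = 1 ∧ μ ≠ μ₀} → SpT =>
            legIns i k μ₀ x₀ x π' - legIns i k μ₀ x₀ x π) ⁻¹' N =
            {x | x ⟨π', hπ', hπ'μ₀⟩ - x ⟨π, hπ, hπμ₀⟩ ∈ N} := by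
          ext x
          simp only [mem_preimage, mem_setOf_eq, legIns_apply_of_pos i k μ₀ x₀ x ⟨hπ', hπ'μ₀⟩,
            legIns_apply_of_pos i k μ₀ x₀ x ⟨hπ, hπμ₀⟩]
        rw [hset]
        exact volume_sub_mem_null _ _ (fun h => hππ' (congrArg Subtype.val h).symm) hN hN0
  have hdmap : Measure.QuasiMeasurePreserving (fun x : {μ : Fin 4 // i μ = 1 ∧ μ ≠ μ₀} → SpT =>
      legIns i k μ₀ x₀ x π' - legIns i k μ₀ x₀ x π) volume volume :=
    ⟨hdmeas, Measure.AbsolutelyContinuous.mk fun N hN hN0 => by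
      rw [Measure.map_apply hdmeas hN]; exact hnull N hN hN0⟩
  have hae' := hdmap.ae hae
  filter_upwards [hae'] with x hx
  rw [hT x, hx, mul_zero]

/-! ### §5 Lemma II.16 at `δ⃗ = 0`: the component bound with momentum-dependent survivors, and the assembly -/

variable (D : LadderData)

/-- The constant `3⁴ · max(1,cst)⁴` is at least one. [folklore] -/
private theorem one_le_resectConst' (cst : ℝ) :
    (1 : ENNReal) ≤ 3 ^ 4 * ENNReal.ofReal (max 1 cst) ^ 4 := by
  have hc : 1 ≤ ENNReal.ofReal (max 1 cst) := by
    rw [← ENNReal.ofReal_one]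
    exact ENNReal.ofReal_le_ofReal (le_max_left _ _)
  calc (1 : ENNReal) = 1 * 1 := (one_mul 1).symm
    _ ≤ 3 ^ 4 * ENNReal.ofReal (max 1 cst) ^ 4 :=
        mul_le_mul' (one_le_pow₀ (by norm_num)) (one_le_pow₀ hc)

/-- **Lemma II.16 at `δ⃗ = 0`, one leg-kind component — F7h's `legNorm_resectFour_le_of_neighbours`
with MOMENTUM-DEPENDENT survivor sets and ALMOST-EVERYWHERE vanishing.**  Let `1 ≤ l' ≤ l`,
`1 ≤ r' ≤ r`, `i` a leg-kind vector with a position leg, `f|_i` measurable in its continuous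
arguments for every label assignment.  ASSUME: a survivor map `N` assigning to the frozen momenta `k`,
a leg `μ` and a new label `a` at most `3` old labels, such that whenever on some position leg `μ` that
changes scale the old label `s' μ` is not a survivor, the `s'`-summand `resectTerm D l' r' l r f i s s'`
vanishes at almost every point of every slice of the `L¹–L^∞` norm with momenta `k` (one position leg
frozen, the others free).  THEN
`‖(f_{Σ_l,Σ_r})|_i‖^{(0,0,0)} ≤ 3⁴ · max(1,cst)⁴ · ‖f|_i‖^{(0,0,0)}_{Σ_{l'},Σ_{r'}}`, `cst` the constant of
`ChiDecayBound`.  Same computation as F7h (p.13 L55–72 at `α = β = 0`: norm under the integral,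
Tonelli, `∫|χ̂_{s_ν}| = ‖χ̂_{s_ν}‖_{L¹}`, `3⁴` surviving labels), the dropped summands now being removed
under the slice integral (`lintegral_mono_ae`).
[cite: FeldmanKnorrerTrubowitz2004Ladders, Lemma II.16 (p.13 L19–33), proof p.13 L37–72] -/
theorem legNorm_resectFour_le_of_neighbours_ae {cst : ℝ} (hχ : ChiDecayBound D cst)
    {l l' r r' : ℕ} (hl' : 1 ≤ l') (hl : l' ≤ l) (hr' : 1 ≤ r') (hr : r' ≤ r)
    (i : LegKind) (hi : ∃ μ, i μ = 1)
    (f : FourLegFn) (hf : ∀ s' : Fin 4 → Arc, Measurable fun y : Fin 4 → SpT => f i y s')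
    (N : (Fin 4 → SpT) → Fin 4 → Arc → Finset Arc) (hN : ∀ k μ a, (N k μ a).card ≤ 3)
    (hvan : ∀ (s s' : Fin 4 → Arc) (k : Fin 4 → SpT) (μ₀ : Fin 4) (x₀ : SpT),
      AdmissibleLabels (D.Sig l) (D.Sig r) i s → AdmissibleLabels (D.Sig l') (D.Sig r') i s' →
      i μ₀ = 1 →
      (∃ μ : Fin 4, (i μ = 1 ∧ ((μ.val < 2 ∧ l ≠ l') ∨ (2 ≤ μ.val ∧ r ≠ r'))) ∧ s' μ ∉ N k μ (s μ)) →
      ∀ᵐ x : ({μ : Fin 4 // i μ = 1 ∧ μ ≠ μ₀} → SpT),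
        resectTerm D l' r' l r f i s s' (legIns i k μ₀ x₀ x) = 0) :
    legNorm (D.Sig l) (D.Sig r) i 0 0 0 (resectFour D l' r' l r f i) ≤
      3 ^ 4 * ENNReal.ofReal (max 1 cst) ^ 4 * legNorm (D.Sig l') (D.Sig r') i 0 0 0 (f i) := by
  classical
  have hdd : ∀ (μ μ' : Fin 4) (g : (Fin 4 → SpT) → ℂ), diffDecay i μ μ' 0 g = g :=
    fun μ μ' g => diffDecay_zero i μ μ' g
  set R := legNorm (D.Sig l') (D.Sig r') i 0 0 0 (f i) with hR
  set c₁ : ENNReal := ENNReal.ofReal (max 1 cst) with hc₁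
  have hc₁1 : 1 ≤ c₁ := by
    rw [hc₁, ← ENNReal.ofReal_one]
    exact ENNReal.ofReal_le_ofReal (le_max_left _ _)
  unfold legNorm
  simp only [hdd]
  refine iSup₂_le fun s hs => iSup_le fun k => iSup₂_le fun μ _ => iSup₂_le fun μ' _ => ?_
  rw [l1linfLegs_eq_iSup i _ k hi]
  refine iSup_le fun μ₀ => iSup_le fun x₀ => ?_
  -- (a) the slice of `|f(·, s')|` is dominated by the old norm, for admissible old labels
  have hS : ∀ s' : Fin 4 → Arc, AdmissibleLabels (D.Sig l') (D.Sig r') i s' →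
      (⨆ t : SpT, ∫⁻ x : ({μ : Fin 4 // i μ = 1 ∧ μ ≠ μ₀.1} → SpT),
        ‖f i (legIns i k μ₀.1 t x) s'‖ₑ) ≤ R := by
    intro s' hs'
    rw [hR, legNorm]
    refine le_iSup₂_of_le s' hs' (le_iSup_of_le k (le_iSup₂_of_le 0 (Or.inl rfl)
      (le_iSup₂_of_le 2 (Or.inl rfl) ?_)))
    rw [hdd, hdd, hdd, l1linfLegs_eq_iSup i _ k hi]
    exact le_iSup_of_le μ₀ le_rfl
  -- (b) `‖χ̂_{s_μ}‖_{L¹} ≤ max(1,cst)` on the legs that change scale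
  have hK : ∀ μ : Fin 4, i μ = 1 ∧ ((μ.val < 2 ∧ l ≠ l') ∨ (2 ≤ μ.val ∧ r ≠ r')) →
      ∫⁻ t, ‖chiHat (D.χ (if μ.val < 2 then l else r) (s μ)) t‖ₑ ≤ c₁ := by
    intro μ hμ
    have h1 := (hs μ).1 hμ.1
    have hsc : 1 ≤ (if μ.val < 2 then l else r) ∧ s μ ∈ D.Sig (if μ.val < 2 then l else r) := by
      split_ifs with hlt
      · exact ⟨hl'.trans hl, h1.1 hlt⟩
      · exact ⟨hr'.trans hr, h1.2 (by omega)⟩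
    exact (lintegral_enorm_chiHat_le_of_chiDecayBound hχ hsc.1 hsc.2).trans
      (ENNReal.ofReal_le_ofReal (le_max_right _ _))
  -- (c) the boxes of old labels: all of them, and the surviving ones (momentum-dependent)
  set oldBox : Fin 4 → Finset Arc := fun μ =>
    if i μ = 1 ∧ ((μ.val < 2 ∧ l ≠ l') ∨ (2 ≤ μ.val ∧ r ≠ r'))
    then (if μ.val < 2 then D.Sig l' else D.Sig r') else {s μ} with holdBox
  set redBox : Fin 4 → Finset Arc := fun μ =>
    if i μ = 1 ∧ ((μ.val < 2 ∧ l ≠ l') ∨ (2 ≤ μ.val ∧ r ≠ r'))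
    then (if μ.val < 2 then D.Sig l' else D.Sig r') ∩ N k μ (s μ) else {s μ} with hredBox
  have hsum : ∀ y, resectFour D l' r' l r f i y s =
      ∑ s' ∈ Fintype.piFinset oldBox, resectTerm D l' r' l r f i s s' y :=
    fun y => resectFour_eq_sum_resectTerm D l' r' l r f i y s
  have hsub : Fintype.piFinset redBox ⊆ Fintype.piFinset oldBox := by
    refine Fintype.piFinset_subset _ _ fun μ => ?_
    simp only [hredBox, holdBox]
    split_ifs <;> first
      | exact Finset.inter_subset_left
      | exact Finset.Subset.refl _
  have hadm_old : ∀ s' ∈ Fintype.piFinset oldBox, AdmissibleLabels (D.Sig l') (D.Sig r') i s' := by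
    intro s' hs' μ
    rw [Fintype.mem_piFinset] at hs'
    have hμ := hs' μ
    simp only [holdBox] at hμ
    refine ⟨fun hi1 => ?_, fun hi0 => ?_⟩
    · by_cases hc : (μ.val < 2 ∧ l ≠ l') ∨ (2 ≤ μ.val ∧ r ≠ r')
      · rw [if_pos ⟨hi1, hc⟩] at hμ
        refine ⟨fun hlt => ?_, fun hge => ?_⟩
        · simpa [hlt] using hμ
        · have hnlt : ¬ μ.val < 2 := by omega
          simpa [hnlt] using hμ
      · rw [if_neg (fun h => hc h.2), Finset.mem_singleton] at hμ
        rw [hμ]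
        have h1 := (hs μ).1 hi1
        push Not at hc
        refine ⟨fun hlt => ?_, fun hge => ?_⟩
        · rw [← hc.1 hlt]; exact h1.1 hlt
        · rw [← hc.2 hge]; exact h1.2 hge
    · have hc : ¬ (i μ = 1 ∧ ((μ.val < 2 ∧ l ≠ l') ∨ (2 ≤ μ.val ∧ r ≠ r'))) := fun h => by
        have := h.1; omega
      rw [if_neg hc, Finset.mem_singleton] at hμ
      rw [hμ]
      exact (hs μ).2 hi0
  have hcard : (Fintype.piFinset redBox).card ≤ 3 ^ 4 := by
    rw [Fintype.card_piFinset]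
    have h3 : ∀ μ, (redBox μ).card ≤ 3 := by
      intro μ
      simp only [hredBox]
      split_ifs <;> first
        | exact (Finset.card_le_card Finset.inter_subset_right).trans (hN k μ (s μ))
        | (rw [Finset.card_singleton]; omega)
    calc ∏ μ, (redBox μ).card ≤ ∏ _μ : Fin 4, 3 := Finset.prod_le_prod' fun μ _ => h3 μ
      _ = 3 ^ 4 := by simp
  -- (d) almost everywhere on the slice: the dropped summands vanish, the survivors are majorised
  have hdrop : ∀ᵐ x : ({μ : Fin 4 // i μ = 1 ∧ μ ≠ μ₀.1} → SpT),
      ∀ s' ∈ Fintype.piFinset oldBox \ Fintype.piFinset redBox,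
        resectTerm D l' r' l r f i s s' (legIns i k μ₀.1 x₀ x) = 0 := by
    rw [Filter.eventually_all_finset]
    intro s' hs'
    obtain ⟨hs'old, hs'red⟩ := Finset.mem_sdiff.1 hs'
    apply hvan s s' k μ₀.1 x₀ hs (hadm_old s' hs'old) μ₀.2
    rw [Fintype.mem_piFinset] at hs'old hs'red
    push Not at hs'red
    obtain ⟨μ, hμ⟩ := hs'red
    have hμold := hs'old μ
    simp only [holdBox] at hμold
    simp only [hredBox] at hμ
    by_cases hc : i μ = 1 ∧ ((μ.val < 2 ∧ l ≠ l') ∨ (2 ≤ μ.val ∧ r ≠ r'))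
    · rw [if_pos hc] at hμold hμ
      exact ⟨μ, hc, fun hN' => hμ (Finset.mem_inter.mpr ⟨hμold, hN'⟩)⟩
    · rw [if_neg hc] at hμold hμ
      exact absurd hμold hμ
  have hpt : ∀ᵐ x : ({μ : Fin 4 // i μ = 1 ∧ μ ≠ μ₀.1} → SpT),
      ‖resectFour D l' r' l r f i (legIns i k μ₀.1 x₀ x) s‖ₑ ≤
      ∑ s' ∈ Fintype.piFinset redBox,
        convMajor (fun μ : Fin 4 => i μ = 1 ∧ ((μ.val < 2 ∧ l ≠ l') ∨ (2 ≤ μ.val ∧ r ≠ r')))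
          (fun μ => chiHat (D.χ (if μ.1.val < 2 then l else r) (s μ.1)))
          (fun μ => (-1 : ℝ) ^ bExp μ.1) (fun y => f i y s') (legIns i k μ₀.1 x₀ x) := by
    filter_upwards [hdrop] with x hx
    rw [hsum, ← Finset.sum_subset hsub ?_]
    · refine (enorm_sum_le _ _).trans (Finset.sum_le_sum fun s' _ => ?_)
      rw [resectTerm_eq_convTerm]
      exact enorm_convTerm_le_convMajor _ _ _ _
    · intro s' hs'old hs'red
      exact hx s' (Finset.mem_sdiff.2 ⟨hs'old, hs'red⟩)
  -- (e) integrate over the slice and use the analytic core of F7h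
  calc ∫⁻ x : ({μ : Fin 4 // i μ = 1 ∧ μ ≠ μ₀.1} → SpT),
        ‖resectFour D l' r' l r f i (legIns i k μ₀.1 x₀ x) s‖ₑ
      ≤ ∫⁻ x : ({μ : Fin 4 // i μ = 1 ∧ μ ≠ μ₀.1} → SpT), ∑ s' ∈ Fintype.piFinset redBox,
          convMajor (fun μ : Fin 4 => i μ = 1 ∧ ((μ.val < 2 ∧ l ≠ l') ∨ (2 ≤ μ.val ∧ r ≠ r')))
            (fun μ => chiHat (D.χ (if μ.1.val < 2 then l else r) (s μ.1)))
            (fun μ => (-1 : ℝ) ^ bExp μ.1) (fun y => f i y s') (legIns i k μ₀.1 x₀ x) :=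
        lintegral_mono_ae hpt
    _ = ∑ s' ∈ Fintype.piFinset redBox, ∫⁻ x : ({μ : Fin 4 // i μ = 1 ∧ μ ≠ μ₀.1} → SpT),
          convMajor (fun μ : Fin 4 => i μ = 1 ∧ ((μ.val < 2 ∧ l ≠ l') ∨ (2 ≤ μ.val ∧ r ≠ r')))
            (fun μ => chiHat (D.χ (if μ.1.val < 2 then l else r) (s μ.1)))
            (fun μ => (-1 : ℝ) ^ bExp μ.1) (fun y => f i y s') (legIns i k μ₀.1 x₀ x) := by
        refine lintegral_finsetSum _ fun s' _ => ?_
        exact (measurable_convMajor _ (fun μ => measurable_chiHat _) _ _ (hf s')).comp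
          (measurable_legIns i k μ₀.1 x₀)
    _ ≤ ∑ s' ∈ Fintype.piFinset redBox, c₁ ^ 4 * R := by
        refine Finset.sum_le_sum fun s' hs' => ?_
        refine (lintegral_convMajor_legIns_le i (fun μ h => h.1) _ (fun μ => measurable_chiHat _)
          _ (fun μ => neg_one_pow_bExp μ.1) _ (hf s') k μ₀.1 x₀).trans ?_
        refine mul_le_mul' ?_ (hS s' (hadm_old s' (hsub hs')))
        calc ∏ μ : {μ : Fin 4 // i μ = 1 ∧ ((μ.val < 2 ∧ l ≠ l') ∨ (2 ≤ μ.val ∧ r ≠ r'))},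
              ∫⁻ t, ‖chiHat (D.χ (if μ.1.val < 2 then l else r) (s μ.1)) t‖ₑ
            ≤ ∏ _μ : {μ : Fin 4 // i μ = 1 ∧ ((μ.val < 2 ∧ l ≠ l') ∨ (2 ≤ μ.val ∧ r ≠ r'))}, c₁ :=
              Finset.prod_le_prod' fun μ _ => hK μ.1 μ.2
          _ = c₁ ^ Fintype.card
                {μ : Fin 4 // i μ = 1 ∧ ((μ.val < 2 ∧ l ≠ l') ∨ (2 ≤ μ.val ∧ r ≠ r'))} := by
              simp
          _ ≤ c₁ ^ 4 := pow_le_pow_right₀ hc₁1 ((Fintype.card_subtype_le _).trans (by simp))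
    _ = (Fintype.piFinset redBox).card * (c₁ ^ 4 * R) := by
        simp [Finset.sum_const, nsmul_eq_mul]
    _ ≤ 3 ^ 4 * (c₁ ^ 4 * R) := by
        gcongr
        exact_mod_cast hcard
    _ = 3 ^ 4 * c₁ ^ 4 * R := (mul_assoc _ _ _).symm

/-- **Lemma II.16 at `δ⃗ = 0` (second inequality), modulo a momentum-dependent survivor map with
a.e. vanishing** — the sum over the sixteen components of `legNorm_resectFour_le_of_neighbours_ae`
(components without position legs: resectorisation is the identity, F7h's
`legNorm_resectFour_le_of_noPos`). [cite: FeldmanKnorrerTrubowitz2004Ladders, Lemma II.16 (p.13 L19–33), proof p.13 L37–72] -/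
theorem resectScaledNormMax_zero_le_of_neighbours_ae {cst : ℝ} (hχ : ChiDecayBound D cst)
    {l l' r r' : ℕ} (hl' : 1 ≤ l') (hl : l' ≤ l) (hr' : 1 ≤ r') (hr : r' ≤ r)
    (f : FourLegFn) (hf : ∀ (i : LegKind) (s' : Fin 4 → Arc), Measurable fun y : Fin 4 → SpT => f i y s')
    (N : LegKind → (Fin 4 → SpT) → Fin 4 → Arc → Finset Arc) (hN : ∀ i k μ a, (N i k μ a).card ≤ 3)
    (hvan : ∀ (i : LegKind) (s s' : Fin 4 → Arc) (k : Fin 4 → SpT) (μ₀ : Fin 4) (x₀ : SpT),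
      AdmissibleLabels (D.Sig l) (D.Sig r) i s → AdmissibleLabels (D.Sig l') (D.Sig r') i s' →
      i μ₀ = 1 →
      (∃ μ : Fin 4, (i μ = 1 ∧ ((μ.val < 2 ∧ l ≠ l') ∨ (2 ≤ μ.val ∧ r ≠ r'))) ∧ s' μ ∉ N i k μ (s μ)) →
      ∀ᵐ x : ({μ : Fin 4 // i μ = 1 ∧ μ ≠ μ₀} → SpT),
        resectTerm D l' r' l r f i s s' (legIns i k μ₀ x₀ x) = 0) :
    resectScaledNormMax D l' r' l r 0 0 0 f ≤
      3 ^ 4 * ENNReal.ofReal (max 1 cst) ^ 4 * scaledNormMax D l' r' 0 0 0 f := by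
  unfold resectScaledNormMax
  rw [scaledNormMax_zero, scaledNormMax_zero]
  unfold fourNormCoeff
  rw [Finset.mul_sum]
  refine Finset.sum_le_sum fun i _ => ?_
  by_cases hi : ∃ μ, i μ = 1
  · exact legNorm_resectFour_le_of_neighbours_ae D hχ hl' hl hr' hr i hi f (hf i) (N i) (hN i) (hvan i)
  · push Not at hi
    have hi0 : ∀ μ, i μ = 0 := fun μ => by have := hi μ; omega
    exact legNorm_resectFour_le_of_noPos D cst l l' r r' i hi0 f

/-- On each side at most two position legs keep their scale: if `μ` changes scale and `π₁ ≠ π₂` are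
position legs that do not, every position leg that does not change scale is one of `π₁, π₂`.
[cite: FeldmanKnorrerTrubowitz2004Ladders, Definition I.18 (ii) (p.8 L55–93)] -/
theorem eq_or_eq_of_not_chg {l l' r r' : ℕ} {μ π₁ π₂ m : Fin 4}
    (hμ : (μ.val < 2 ∧ l ≠ l') ∨ (2 ≤ μ.val ∧ r ≠ r'))
    (h₁ : ¬ ((π₁.val < 2 ∧ l ≠ l') ∨ (2 ≤ π₁.val ∧ r ≠ r')))
    (h₂ : ¬ ((π₂.val < 2 ∧ l ≠ l') ∨ (2 ≤ π₂.val ∧ r ≠ r'))) (hne : π₁ ≠ π₂)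
    (hm : ¬ ((m.val < 2 ∧ l ≠ l') ∨ (2 ≤ m.val ∧ r ≠ r'))) : m = π₁ ∨ m = π₂ := by
  have h1 := π₁.isLt
  have h2 := π₂.isLt
  have h3 := m.isLt
  have h4 := μ.isLt
  have hne' : π₁.val ≠ π₂.val := fun h => hne (Fin.ext h)
  rw [Fin.ext_iff, Fin.ext_iff]
  omega

/-- **Lemma II.16 (`\lemLADresectornorm`) at `δ⃗ = (0,0,0)` — every leg-kind component, every side
pattern.**  For admissible ladder data with `χ̂`-decay constant `cst` (`ChiDecayBound D cst`, the
`δ = 0` instance `‖χ̂_s‖_{L¹} ≤ cst` of `LadderData.Admissible.chi_decay`), scales `1 ≤ ℓ' ≤ ℓ`,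
`1 ≤ r' ≤ r`, and `f` on `𝔜_{ℓ',r'}` sectorized (Definition I.6), translation invariant (Definition I.4)
and with Borel measurable components:
`|f|^{[0,0,0]}_{ℓ,r} = |f_{Σ_ℓ,Σ_r}|^{[0,0,0]}_{ℓ,r} ≤ 3⁴ · max(1,cst)⁴ · |f|^{[0,0,0]}_{ℓ',r'}` — the printed
`|f|^{[δ⃗]}_{ℓ,r} ≤ const |f|^{[δ⃗]}_{ℓ',r'}` in the derivative-free case, with an explicit constant depending
only on the fixed data.  ASSEMBLY of the printed proof (p.13 L37–72): if the old norm is infinite the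
bound is trivial; otherwise every pinned slice of every component is integrable (F7h §8), and the "at
most `3⁴` surviving old labels" step holds in the following form, leg-kind component by component
(`P` = position legs, `chg` = position legs on a side that changes scale, `ν ∈ chg` the leg whose old
label is not a survivor): `|P| = 1` — survivors = old sectors containing the conserved momentum (`≤ 2`,
F7i), the other summands vanish identically (`resectTerm_eq_zero_of_not_mem_extSector_single`);
`|P| ≥ 2` — survivors = old sectors meeting the new one (`≤ 3`, F7i), the other summands vanish
identically when every position leg changes scale (F7m `resectTerm_eq_zero_of_extSector_disjoint_gen`)
or exactly one does not (`integral_resect_eq_zero_of_disjoint_pinFree`), and almost everywhere on every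
slice when two do not (`ae_integral_resect_eq_zero_of_disjoint_twoFree`); then
`resectScaledNormMax_zero_le_of_neighbours_ae`.  The named fact `ResectorizationNormBound` (all `δ⃗`,
all `f`) is NOT discharged: `δ⃗ ≠ 0` needs the Leibniz step through `diffDecay`, and measurability is
assumed here.  (t10's `resectScaledNormMax_zero_le` in `FKTLaddersSupportVanishingSingle` is the strict
pattern `ℓ' < ℓ`, `r' < r`; this is the Lemma's full hypothesis `ℓ ≥ ℓ' ≥ 1`, `r ≥ r' ≥ 1`.)
[cite: FeldmanKnorrerTrubowitz2004Ladders, Lemma II.16 (p.13 L19–33), proof p.13 L37–72] -/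
theorem resectScaledNormMax_zero_le_of_le (hD : D.Admissible) {cst : ℝ} (hχ : ChiDecayBound D cst)
    {l l' r r' : ℕ} (hl' : 1 ≤ l') (hl : l' ≤ l) (hr' : 1 ≤ r') (hr : r' ≤ r) (f : FourLegFn)
    (hsec : IsSectorized D.S D.e D.fr l' r' f) (htr : IsTranslationInvariant f)
    (hf : ∀ (i : LegKind) (s' : Fin 4 → Arc), Measurable fun y : Fin 4 → SpT => f i y s') :
    resectScaledNormMax D l' r' l r 0 0 0 f ≤
      3 ^ 4 * ENNReal.ofReal (max 1 cst) ^ 4 * scaledNormMax D l' r' 0 0 0 f := by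
  classical
  by_cases htop : scaledNormMax D l' r' 0 0 0 f = ⊤
  · have hC : (3 ^ 4 * ENNReal.ofReal (max 1 cst) ^ 4 : ENNReal) ≠ 0 :=
      ne_of_gt (lt_of_lt_of_le zero_lt_one (one_le_resectConst' cst))
    rw [htop, ENNReal.mul_top hC]
    exact le_top
  -- finiteness of the old norm: every pinned slice of every component is integrable
  have hint : ∀ (i : LegKind) (s' : Fin 4 → Arc), AdmissibleLabels (D.Sig l') (D.Sig r') i s' →
      ∀ (k : Fin 4 → SpT) (π₀ : Fin 4), i π₀ = 1 →
        Integrable fun u : {μ : Fin 4 // i μ = 1 ∧ μ ≠ π₀} → SpT => f i (legIns i k π₀ 0 u) s' :=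
    fun i s' hs' k π₀ hπ₀ => integrable_slice_of_scaledNormMax_ne_top D l' r' f htop i s' hs' (hf i s') k π₀ hπ₀ 0
  -- the survivor map: sectors containing the conserved momentum (single position leg) / meeting the
  -- new sector (otherwise)
  let N : LegKind → (Fin 4 → SpT) → Fin 4 → Arc → Finset Arc := fun i k μ a =>
    if (∃ π : Fin 4, i π = 1 ∧ π ≠ μ) then
      (if a ∈ D.Sig (if μ.val < 2 then l else r) then
        (D.Sig (if μ.val < 2 then l' else r')).filter fun b =>
          (extSector D.S D.e D.fr (if μ.val < 2 then l else r) a ∩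
            extSector D.S D.e D.fr (if μ.val < 2 then l' else r') b).Nonempty
      else ∅)
    else
      (D.Sig (if μ.val < 2 then l' else r')).filter fun b =>
        -(((-1 : ℝ) ^ bExp μ) • ∑ m ∈ Finset.univ.erase μ, ((-1 : ℝ) ^ bExp m) • k m) ∈
          extSector D.S D.e D.fr (if μ.val < 2 then l' else r') b
  have hold1 : ∀ μ : Fin 4, 1 ≤ (if μ.val < 2 then l' else r') := fun μ => by
    split_ifs <;> assumption
  have hnew1 : ∀ μ : Fin 4, 1 ≤ (if μ.val < 2 then l else r) := fun μ => by
    split_ifs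
    · exact hl'.trans hl
    · exact hr'.trans hr
  refine resectScaledNormMax_zero_le_of_neighbours_ae D hχ hl' hl hr' hr f hf N ?_ ?_
  · -- at most three survivors
    intro i k μ a
    by_cases hP : ∃ π : Fin 4, i π = 1 ∧ π ≠ μ
    · simp only [N, if_pos hP]
      by_cases ha : a ∈ D.Sig (if μ.val < 2 then l else r)
      · rw [if_pos ha]
        by_cases hμ : μ.val < 2
        · simp only [hμ, if_true] at ha ⊢
          exact card_filter_extSector_inter_nonempty_le_three D hD hl' hl ha
        · simp only [hμ, if_false] at ha ⊢
          exact card_filter_extSector_inter_nonempty_le_three D hD hr' hr ha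
      · rw [if_neg ha, Finset.card_empty]
        omega
    · simp only [N, if_neg hP]
      exact (card_filter_mem_extSector_le_two D hD (hold1 μ) _).trans (by norm_num)
  · -- the non-survivors vanish (a.e. on every slice)
    rintro i s s' k μ₀ x₀ hs hs' hμ₀ ⟨μ, ⟨hiμ, hcμ⟩, hNμ⟩
    have hsμ : s μ ∈ D.Sig (if μ.val < 2 then l else r) := by
      have h1 := (hs μ).1 hiμ
      split_ifs with h
      · exact h1.1 h
      · exact h1.2 (by omega)
    have hsμ' : s μ ∈ (if μ.val < 2 then D.Sig l else D.Sig r) := by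
      have h1 := (hs μ).1 hiμ
      split_ifs with h
      · exact h1.1 h
      · exact h1.2 (by omega)
    have hs'μ : s' μ ∈ D.Sig (if μ.val < 2 then l' else r') := by
      have h1 := (hs' μ).1 hiμ
      split_ifs with h
      · exact h1.1 h
      · exact h1.2 (by omega)
    by_cases hP : ∃ π : Fin 4, i π = 1 ∧ π ≠ μ
    · -- `|P| ≥ 2`: the old sector on leg `μ` does not meet the new one
      simp only [N, if_pos hP, if_pos hsμ] at hNμ
      have hdisj : extSector D.S D.e D.fr (if μ.val < 2 then l else r) (s μ) ∩
          extSector D.S D.e D.fr (if μ.val < 2 then l' else r') (s' μ) = ∅ := by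
        apply Set.not_nonempty_iff_eq_empty.1
        intro hne
        exact hNμ (Finset.mem_filter.2 ⟨hs'μ, hne⟩)
      -- the canonical `chg` of `resectTerm D l' r' l r`
      set chgP : Fin 4 → Prop := fun m => i m = 1 ∧ ((m.val < 2 ∧ l ≠ l') ∨ (2 ≤ m.val ∧ r ≠ r'))
        with hchgP
      by_cases hA : ∀ m : Fin 4, i m = 1 → ((m.val < 2 ∧ l ≠ l') ∨ (2 ≤ m.val ∧ r ≠ r'))
      · -- (a) every position leg changes scale: F7m, identically
        obtain ⟨π, hπ1, hπμ⟩ := hP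
        exact ae_of_all _ fun x =>
          resectTerm_eq_zero_of_extSector_disjoint_gen D hD (hl'.trans hl) (hr'.trans hr) hA hsec htr
            s s' (legIns i k μ₀ x₀ x) (fun π₀ h₀ => hint i s' hs' _ π₀ h₀) hiμ hπ1 hπμ.symm hsμ' hdisj
      · obtain ⟨π₁, hπ₁⟩ := not_forall.1 hA
        obtain ⟨hπ₁1, hπ₁c⟩ := Classical.not_imp.1 hπ₁
        by_cases hB : ∀ m : Fin 4, i m = 1 → ¬ ((m.val < 2 ∧ l ≠ l') ∨ (2 ≤ m.val ∧ r ≠ r')) → m = π₁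
        · -- (c) exactly one position leg keeps its scale: identically
          have hchg : ∀ m, chgP m ↔ (i m = 1 ∧ m ≠ π₁) := by
            intro m
            refine ⟨fun h => ⟨h.1, fun hm => hπ₁c (hm ▸ h.2)⟩, fun h => ⟨h.1, ?_⟩⟩
            by_contra hc
            exact h.2 (hB m h.1 hc)
          exact ae_of_all _ fun x =>
            integral_resect_eq_zero_of_disjoint_pinFree D hD hsec htr s s' chgP hπ₁1 hchg
              (show chgP μ from ⟨hiμ, hcμ⟩) (hnew1 μ) hsμ hdisj
              (fun k' π₀ h₀ => hint i s' hs' k' π₀ h₀) (legIns i k μ₀ x₀ x)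
        · -- (d) two position legs keep their scale: almost everywhere on the slice
          obtain ⟨π₂, hπ₂⟩ := not_forall.1 hB
          obtain ⟨hπ₂1, hπ₂'⟩ := Classical.not_imp.1 hπ₂
          obtain ⟨hπ₂c, hπ₂ne⟩ := Classical.not_imp.1 hπ₂'
          have hne : π₁ ≠ π₂ := fun h => hπ₂ne h.symm
          have hchg : ∀ m, chgP m ↔ (i m = 1 ∧ m ≠ π₁ ∧ m ≠ π₂) := by
            intro m
            refine ⟨fun h => ⟨h.1, fun hm => hπ₁c (hm ▸ h.2), fun hm => hπ₂c (hm ▸ h.2)⟩,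
              fun h => ⟨h.1, ?_⟩⟩
            by_contra hc
            rcases eq_or_eq_of_not_chg hcμ hπ₁c hπ₂c hne hc with h' | h'
            · exact h.2.1 h'
            · exact h.2.2 h'
          exact ae_integral_resect_eq_zero_of_disjoint_twoFree D hD hsec htr s s' chgP hπ₁1 hπ₂1 hne
            hchg (show chgP μ from ⟨hiμ, hcμ⟩) (hnew1 μ) hsμ hdisj
            (fun k' π₀ h₀ => hint i s' hs' k' π₀ h₀) k μ₀ hμ₀ x₀
    · -- `|P| = 1`: the conserved momentum is outside the old sector on leg `μ`
      simp only [N, if_neg hP] at hNμ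
      have huniq : ∀ m, i m = 1 → m = μ := by
        intro m hm
        by_contra hne
        exact hP ⟨m, hm, hne⟩
      set K : SpT := -(((-1 : ℝ) ^ bExp μ) • ∑ m ∈ Finset.univ.erase μ, ((-1 : ℝ) ^ bExp m) • k m)
        with hK
      have hKν : K ∉ extSector D.S D.e D.fr (if μ.val < 2 then l' else r') (s' μ) :=
        fun hmem => hNμ (Finset.mem_filter.2 ⟨hs'μ, hmem⟩)
      refine ae_of_all _ fun x => ?_
      refine resectTerm_eq_zero_of_not_mem_extSector_single D hsec htr s s' hiμ huniq
        (legIns i k μ₀ x₀ x) (Function.update k μ K) (surface_update_conserved μ k) (fun m hm => ?_) ?_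
      · have hmμ : m ≠ μ := fun h => hm (h ▸ hiμ)
        have hmμ₀ : m ≠ μ₀ := fun h => hm (h ▸ hμ₀)
        rw [Function.update_of_ne hmμ, legIns_apply_of_mom i k μ₀ x₀ x hm hmμ₀]
      · rw [Function.update_self]
        exact hKν

/-- **Lemma II.16 at `δ⃗ = 0` in the printed two-inequality shape, constant existentially
quantified as in the named fact `ResectorizationNormBound`** (restricted to `δ_l = δ_c = δ_r = 0` and to
`f` with Borel measurable components): for admissible ladder data there is `cst > 0` such that for all
`1 ≤ ℓ' ≤ ℓ`, `1 ≤ r' ≤ r` and all such sectorized, translation invariant `f`,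
`|f|^{[0⃗]}_{ℓ,r} ≤ cst { M^{-(ℓ-ℓ')}M^{-(r-r')} |f|^{[0⃗]}_{ℓ',r'} + M^{-(ℓ-ℓ')} |f|^{[0⃗]}_{ℓ',r'} + M^{-(r-r')} |f|^{[0⃗]}_{ℓ',r'}
+ |f|^{[0⃗]}_{ℓ',r'} }` and `|f|^{[0⃗]}_{ℓ,r} ≤ cst |f|^{[0⃗]}_{ℓ',r'}` (at `δ⃗ = 0` the four norms on the
right of the first inequality coincide, so it follows from the second).
[cite: FeldmanKnorrerTrubowitz2004Ladders, Lemma II.16 (p.13 L19–33)] -/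
theorem resectorizationNormBound_deltaZero (hD : D.Admissible) :
    ∃ cst : ℝ, 0 < cst ∧
      ∀ (l l' r r' : ℕ), 1 ≤ l' → l' ≤ l → 1 ≤ r' → r' ≤ r →
        ∀ f : FourLegFn, IsSectorized D.S D.e D.fr l' r' f → IsTranslationInvariant f →
          (∀ (i : LegKind) (s' : Fin 4 → Arc), Measurable fun y : Fin 4 → SpT => f i y s') →
          resectScaledNormMax D l' r' l r 0 0 0 f ≤
              ENNReal.ofReal cst *
                (ENNReal.ofReal ((D.S.M ^ (l - l'))⁻¹ * (D.S.M ^ (r - r'))⁻¹) *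
                    scaledNormMax D l' r' 0 0 0 f +
                  ENNReal.ofReal ((D.S.M ^ (l - l'))⁻¹) * scaledNormMax D l' r' 0 0 0 f +
                  ENNReal.ofReal ((D.S.M ^ (r - r'))⁻¹) * scaledNormMax D l' r' 0 0 0 f +
                  scaledNormMax D l' r' 0 0 0 f) ∧
            resectScaledNormMax D l' r' l r 0 0 0 f ≤
              ENNReal.ofReal cst * scaledNormMax D l' r' 0 0 0 f := by
  obtain ⟨c₀, hc₀⟩ := hD.chi_decay
  refine ⟨3 ^ 4 * (max 1 c₀) ^ 4, by positivity, ?_⟩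
  intro l l' r r' hl' hl hr' hr f hsec htr hf
  have hmax : (0 : ℝ) ≤ max 1 c₀ := le_trans zero_le_one (le_max_left _ _)
  have hconst : ENNReal.ofReal (3 ^ 4 * (max 1 c₀) ^ 4) = 3 ^ 4 * ENNReal.ofReal (max 1 c₀) ^ 4 := by
    rw [ENNReal.ofReal_mul (by positivity), ENNReal.ofReal_pow hmax, ENNReal.ofReal_pow (by norm_num)]
    norm_num
  have h2 : resectScaledNormMax D l' r' l r 0 0 0 f ≤
      ENNReal.ofReal (3 ^ 4 * (max 1 c₀) ^ 4) * scaledNormMax D l' r' 0 0 0 f := by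
    rw [hconst]
    exact resectScaledNormMax_zero_le_of_le D hD hc₀ hl' hl hr' hr f hsec htr hf
  refine ⟨h2.trans ?_, h2⟩
  gcongr
  exact le_add_self

end FKTLadders




end Literature.MathematicalPhysics.QuantumLattice.FermiRG
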